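import Summits.Ventures.PercRepro.C041FourExitMainA
import Summits.Ventures.PercRepro.C041FourExitMainB
import Summits.Ventures.PercRepro.C041FourExitMainC
import Summits.Ventures.PercRepro.C041FourExitMainD
import Summits.Ventures.PercRepro.C041FourExitMainE
import Summits.Ventures.PercRepro.C041FourExitMainF

/-!
# ROW C-041 — THEOREM (FOUR-EXIT BLOCK MAP): the six-vector of a four-exit attachment is the sum over the colourings
of the multigraph of the contributions of the statuses of its four exits (p6, gen 31; generated by gen4main.py)

**`sixVec_glue4`**: `Π(glue4 Z₁ u u' u'' u''' Z a Z' a' Z'' a'' Z''' a''') = ∑_ω contrib4 (Π Z) (Π Z') (Π Z'')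
    (Π Z''')
(the merged / reached statuses of the four exits and the six blue connections among them)` — C-041.md §20 (c) with
r = 4, from the 52 fibre counts (`C041FourExitCntA–H`) and the case lemmas (`C041FourExitMainA–…`).
-/

namespace PercRepro

namespace ZoneZ

namespace TwoExit

open ZoneData TreeClosure Finset

variable {V₁ E₁ U₁ U₂ V E T₁ T₂ V' E' T₁' T₂' V'' E'' T₁'' T₂'' V''' E''' T₁''' T₂''' : Type}
variable (Z₁ : ZoneData V₁ E₁ U₁ U₂) (u u' u'' u''' : V₁) (Z : ZoneData V E T₁ T₂) (a : V)
  (Z' : ZoneData V' E' T₁' T₂') (a' : V') (Z'' : ZoneData V'' E'' T₁'' T₂'') (a'' : V'')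
  (Z''' : ZoneData V''' E''' T₁''' T₂''') (a''' : V''') (a₁ : V₁)
variable [Fintype E₁] [DecidableEq E₁] [Fintype E] [DecidableEq E] [Fintype T₁] [DecidableEq T₁]
  [Fintype T₂] [DecidableEq T₂] [Fintype E'] [DecidableEq E'] [Fintype T₁'] [DecidableEq T₁']
  [Fintype T₂'] [DecidableEq T₂'] [Fintype E''] [DecidableEq E''] [Fintype T₁''] [DecidableEq T₁'']
  [Fintype T₂''] [DecidableEq T₂''] [Fintype E'''] [DecidableEq E'''] [Fintype T₁'''] [DecidableEq T₁''']
  [Fintype T₂'''] [DecidableEq T₂''']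

omit [Fintype E₁] [DecidableEq E₁] in
/-- **The fibre vector is the contribution of the statuses.** -/
theorem fibVec4_eq (ω : E₁ → Bool) :
    fibVec4 Z₁ u u' u'' u''' Z a Z' a' Z'' a'' Z''' a''' a₁ ω = contrib4 (Z.sixVec a) (Z'.sixVec a')
    (Z''.sixVec a'') (Z'''.sixVec a''') (Z₁.Mg a₁ u ω) (Z₁.Rd a₁ u ω) (Z₁.Mg a₁ u' ω) (Z₁.Rd a₁ u' ω)
    (Z₁.Mg a₁ u'' ω) (Z₁.Rd a₁ u'' ω) (Z₁.Mg a₁ u''' ω) (Z₁.Rd a₁ u''' ω) (Z₁.Mg u u' ω) (Z₁.Mg u'' u ω)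
    (Z₁.Mg u''' u ω) (Z₁.Mg u'' u' ω) (Z₁.Mg u''' u' ω) (Z₁.Mg u''' u'' ω) := by
  by_cases hm : Z₁.Mg a₁ u ω <;> by_cases hm' : Z₁.Mg a₁ u' ω <;> by_cases hm'' : Z₁.Mg a₁ u'' ω <;>
    by_cases hm''' : Z₁.Mg a₁ u''' ω
  · exact fibVec4_eq_mmmm Z₁ u u' u'' u''' Z a Z' a' Z'' a'' Z''' a''' a₁ ω hm hm' hm'' hm'''
  · exact fibVec4_eq_mmms Z₁ u u' u'' u''' Z a Z' a' Z'' a'' Z''' a''' a₁ ω hm hm' hm'' hm'''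
  · exact fibVec4_eq_mmsm Z₁ u u' u'' u''' Z a Z' a' Z'' a'' Z''' a''' a₁ ω hm hm' hm'' hm'''
  · exact fibVec4_eq_mmss Z₁ u u' u'' u''' Z a Z' a' Z'' a'' Z''' a''' a₁ ω hm hm' hm'' hm'''
  · exact fibVec4_eq_msmm Z₁ u u' u'' u''' Z a Z' a' Z'' a'' Z''' a''' a₁ ω hm hm' hm'' hm'''
  · exact fibVec4_eq_msms Z₁ u u' u'' u''' Z a Z' a' Z'' a'' Z''' a''' a₁ ω hm hm' hm'' hm'''
  · exact fibVec4_eq_mssm Z₁ u u' u'' u''' Z a Z' a' Z'' a'' Z''' a''' a₁ ω hm hm' hm'' hm'''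
  · exact fibVec4_eq_msss Z₁ u u' u'' u''' Z a Z' a' Z'' a'' Z''' a''' a₁ ω hm hm' hm'' hm'''
  · exact fibVec4_eq_smmm Z₁ u u' u'' u''' Z a Z' a' Z'' a'' Z''' a''' a₁ ω hm hm' hm'' hm'''
  · exact fibVec4_eq_smms Z₁ u u' u'' u''' Z a Z' a' Z'' a'' Z''' a''' a₁ ω hm hm' hm'' hm'''
  · exact fibVec4_eq_smsm Z₁ u u' u'' u''' Z a Z' a' Z'' a'' Z''' a''' a₁ ω hm hm' hm'' hm'''
  · exact fibVec4_eq_smss Z₁ u u' u'' u''' Z a Z' a' Z'' a'' Z''' a''' a₁ ω hm hm' hm'' hm'''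
  · exact fibVec4_eq_ssmm Z₁ u u' u'' u''' Z a Z' a' Z'' a'' Z''' a''' a₁ ω hm hm' hm'' hm'''
  · exact fibVec4_eq_ssms Z₁ u u' u'' u''' Z a Z' a' Z'' a'' Z''' a''' a₁ ω hm hm' hm'' hm'''
  · exact fibVec4_eq_sssm Z₁ u u' u'' u''' Z a Z' a' Z'' a'' Z''' a''' a₁ ω hm hm' hm'' hm'''
  · by_cases hbc12 : Z₁.Mg u u' ω
    · exact fibVec4_eq_ssss_c12 Z₁ u u' u'' u''' Z a Z' a' Z'' a'' Z''' a''' a₁ ω hm hm' hm'' hm''' hbc12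
    · exact fibVec4_eq_ssss_n12 Z₁ u u' u'' u''' Z a Z' a' Z'' a'' Z''' a''' a₁ ω hm hm' hm'' hm''' hbc12

/-- **THEOREM (FOUR-EXIT BLOCK MAP)**: the six-vector of the four-exit attachment, at the anchor `a₁` of the
multigraph, is the sum over the colourings `ω` of `Z₁` of the contribution of the statuses of the four exits. -/
theorem sixVec_glue4 :
    (glue4 Z₁ u u' u'' u''' Z a Z' a' Z'' a'' Z''' a''').sixVec (Sum.inl (Sum.inl (Sum.inl (Sum.inl a₁)))) =
      ∑ ω : E₁ → Bool, contrib4 (Z.sixVec a) (Z'.sixVec a') (Z''.sixVec a'') (Z'''.sixVec a''') (Z₁.Mg a₁ u ω)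
    (Z₁.Rd a₁ u ω) (Z₁.Mg a₁ u' ω) (Z₁.Rd a₁ u' ω) (Z₁.Mg a₁ u'' ω) (Z₁.Rd a₁ u'' ω) (Z₁.Mg a₁ u''' ω)
    (Z₁.Rd a₁ u''' ω) (Z₁.Mg u u' ω) (Z₁.Mg u'' u ω) (Z₁.Mg u''' u ω) (Z₁.Mg u'' u' ω) (Z₁.Mg u''' u' ω)
    (Z₁.Mg u''' u'' ω) := by
  rw [sixVec_eq_sum_fibVec4]
  exact Finset.sum_congr rfl fun ω _ => fibVec4_eq Z₁ u u' u'' u''' Z a Z' a' Z'' a'' Z''' a''' a₁ ω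

end TwoExit

end ZoneZ

end PercRepro
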